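import Literature.NumberTheory.Automorphic.BrandtMatrixRamified
import Literature.NumberTheory.Automorphic.BrandtMultiplicativityHolds
import Literature.NumberTheory.Automorphic.BrandtEigenLine
import HarnessLib

/-!
# The Atkin–Lehner sign of a Brandt eigen-line at a prime `p ∣ N⁻`

Topic `NumberTheory/Automorphic`; theorems only (no definition, no named fact, no instance).
For a Brandt setup `S` of type `(N⁺, N⁻)` (`BrandtXi.lean`) and a prime `p ∣ N⁻`, the Brandt
matrix `T(p) = Brandt.matrix S.O p` is an involution (`Brandt.XiSetup.matrix_mul_self_of_dvd`,
`BrandtMatrixRamified.lean`) commuting with the Hecke matrices `T(ℓ)`, `ℓ ∤ N⁺N⁻`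
(`Brandt.XiSetup.matrix_comm_of_coprime`, `BrandtMultiplicativityHolds.lean`). Hence it preserves
every common eigen-lattice `L(λ) = Brandt.eigenLattice (N⁺N⁻) (Brandt.matrix S.O) λ`
(Pollack–Weston's `M^f`, `BrandtXi.lean`), and on a rank-one eigen-lattice it acts by a **sign**
`ε_p = ±1` — the Atkin–Lehner eigenvalue of the corresponding `N⁻`-new eigenform at `p`:

* `Brandt.exists_sign_of_mulVec_mem_span` — linear algebra: an integer matrix `A` with `A² = 1`
  stabilising a line `ℤ φ`, `φ ≠ 0`, acts on it by `ε ∈ {1, -1}`;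
* `Brandt.XiSetup.mulVec_mem_eigenLattice_of_dvd` — `T(p) L(λ) ⊆ L(λ)` for `p ∣ N⁻`;
* `Brandt.XiSetup.exists_atkinLehnerSign` — **if the rational eigenspace for `λ` is a line
  (multiplicity one), there is `ε ∈ {1, -1}` with `T(p) v = ε v` for all `v ∈ L(λ)`**.

## References

* M.-F. Vignéras, *Arithmétique des algèbres de quaternions*, LNM 800 (1980), Ch. III §5
  exercice 5.8 (b)–(d) [VignerasLNM800].
* R. Pollack, T. Weston, *On anticyclotomic μ-invariants of modular forms*, Compos. Math. 147
  (2011), §2.1 [PollackWeston2011].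
-/

noncomputable section

open scoped Matrix

universe u

namespace Literature.NumberTheory.Automorphic

namespace Brandt

/-! ### An involution stabilising a line acts by `±1` -/

section Line

variable {ι : Type*} [Fintype ι] [DecidableEq ι]

/-- **An integer involution on a line acts by a sign.** If `A² = 1`, `φ ≠ 0` and `A φ ∈ ℤ φ`,
then there is `ε ∈ {1, -1}` with `A v = ε v` for every `v ∈ ℤ φ`. [folklore] -/
theorem exists_sign_of_mulVec_mem_span {A : Matrix ι ι ℤ} (hA : A * A = 1) {φ : ι → ℤ}
    (hφ : φ ≠ 0) (hAφ : A *ᵥ φ ∈ ℤ ∙ φ) :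
    ∃ ε : ℤ, (ε = 1 ∨ ε = -1) ∧ ∀ v ∈ ℤ ∙ φ, A *ᵥ v = ε • v := by
  obtain ⟨c, hc⟩ := Submodule.mem_span_singleton.mp hAφ
  -- `φ = A (A φ) = c² φ`, so `c² = 1`
  have hsq : (c * c) • φ = φ := by
    calc (c * c) • φ = c • (A *ᵥ φ) := by rw [mul_smul, hc]
      _ = A *ᵥ (c • φ) := by rw [Matrix.mulVec_smul]
      _ = A *ᵥ (A *ᵥ φ) := by rw [hc]
      _ = φ := by rw [Matrix.mulVec_mulVec, hA, Matrix.one_mulVec]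
  obtain ⟨i, hi⟩ : ∃ i, φ i ≠ 0 := by
    by_contra h
    push Not at h
    exact hφ (funext h)
  have hcc : c * c = 1 := by
    have h := congrFun hsq i
    simp only [Pi.smul_apply, smul_eq_mul] at h
    have : (c * c - 1) * φ i = 0 := by linear_combination h
    rcases mul_eq_zero.mp this with h1 | h1
    · linear_combination h1
    · exact absurd h1 hi
  refine ⟨c, ?_, fun v hv => ?_⟩
  · exact Int.eq_one_or_neg_one_of_mul_eq_one hcc
  · obtain ⟨a, rfl⟩ := Submodule.mem_span_singleton.mp hv
    rw [Matrix.mulVec_smul, ← hc, smul_comm]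

end Line

/-! ### Brandt setups: `T(p)`, `p ∣ N⁻`, on the eigen-lattice -/

variable {Nplus Nminus : ℕ}

/-- **`T(p)` preserves the eigen-lattice** `L(λ)` for `p ∣ N⁻` (it commutes with the `T(ℓ)`,
`ℓ ∤ N⁺N⁻`, as `gcd(ℓ, p) = 1`). [cite: VignerasLNM800, Ch. III §5 exercice 5.8 (c)–(d)] -/
theorem XiSetup.mulVec_mem_eigenLattice_of_dvd (S : XiSetup Nplus Nminus) [Fintype (ClassSet S.O)]
    {p : ℕ} (hp : p.Prime) (hpN : p ∣ Nminus) {lam : ℕ → ℤ} {v : ClassSet S.O → ℤ}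
    (hv : v ∈ eigenLattice (Nplus * Nminus) (matrix S.O) lam) :
    matrix S.O p *ᵥ v ∈ eigenLattice (Nplus * Nminus) (matrix S.O) lam := by
  intro ℓ hℓ hℓN
  have hℓp : Nat.Coprime ℓ p := (Nat.coprime_primes hℓ hp).mpr fun h =>
    hℓN (h ▸ hpN.trans (dvd_mul_left Nminus Nplus))
  rw [Matrix.mulVec_mulVec, S.matrix_comm_of_coprime hℓp, ← Matrix.mulVec_mulVec, hv ℓ hℓ hℓN,
    Matrix.mulVec_smul]

/-- **The Atkin–Lehner sign.** For a Brandt setup of type `(N⁺, N⁻)`, a prime `p ∣ N⁻` and an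
eigenvalue system `λ` whose rational Brandt eigenspace (primes `ℓ ∤ N⁺N⁻`) is one-dimensional,
`T(p)` acts on the eigen-lattice `L(λ)` by a sign: there is `ε ∈ {1, -1}` with `T(p) v = ε v` for
all `v ∈ L(λ)` (`T(p)² = 1` and `L(λ)` is a line). [cite: VignerasLNM800, Ch. III §5 exercice 5.8 (b)–(d)] -/
theorem XiSetup.exists_atkinLehnerSign (S : XiSetup Nplus Nminus) [Fintype (ClassSet S.O)]
    {p : ℕ} (hp : p.Prime) (hpN : p ∣ Nminus) {lam : ℕ → ℤ}
    (h : Module.finrank ℚ (eigenSpace ℚ (Nplus * Nminus) (matrix S.O) lam) = 1) :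
    ∃ ε : ℤ, (ε = 1 ∨ ε = -1) ∧ ∀ v ∈ eigenLattice (Nplus * Nminus) (matrix S.O) lam,
      matrix S.O p *ᵥ v = ε • v := by
  classical
  obtain ⟨φ, hφ, hL⟩ := exists_eigenLattice_eq_span_of_finrank_eigenSpace_eq_one h
  have hAφ : matrix S.O p *ᵥ φ ∈ ℤ ∙ φ := by
    rw [← hL]
    exact S.mulVec_mem_eigenLattice_of_dvd hp hpN (hL ▸ Submodule.mem_span_singleton_self φ)
  obtain ⟨ε, hε, hεv⟩ := exists_sign_of_mulVec_mem_span (S.matrix_mul_self_of_dvd hp hpN) hφ hAφ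
  exact ⟨ε, hε, fun v hv => hεv v (hL ▸ hv)⟩

end Brandt

end Literature.NumberTheory.Automorphic

end
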